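import Summits.QuantumFields.YangMills.Theorems.Instrument.TorusPolymerKraft
import Literature.MathematicalPhysics.QuantumLattice.MagneticHubbardTorusTrivialField
import HarnessLib

/-!
# Instrument cell `ym-instrument`, crew (b): plaquette ∕ link geometry of the TORUS `(ℤ/L)⁴`, `L ≥ 3` — two distinct torus plaquettes share at most one link; for even `L` every
# torus plaquette has two distinct FREE links of the comb gauge

QUESTIONS.md: Q-B2 (S2-SPEC v0.5.1 §0 reading (β-torus), `L = 2S₀`; RADIUS-DERIVATION v0.6.2 (7.0) Lemma W); cell `run/shared/lean/pub/ym-instrument/`, HUMAN RULING D-0084 (2),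
director-ym R138.  HONEST FRAMING (page 1, binding).  WHAT IS CERTIFIED HERE: PURE COMBINATORICS of the periodic lattice `(ℤ/L)⁴`
(`TorusPolymerKraft.{TSite, TEdge, TPlaquette, tEdges, IsAxisLinkT, IsFreeLinkT}`): (§1) for `L ≥ 3`, two distinct torus plaquettes share at most one link
(`eq_of_mem_tEdges_of_ne` — the `ℤ⁴` proof `PlaquetteLinkGeometry.eq_of_mem_plaquetteEdges_of_ne` verbatim, the three lattice facts `e_m ≠ 0`, `e_m + e_n ≠ 0`, `e_m = e_n → m = n`
holding in `ZMod L` for `L ≥ 3`; the first two are the tree's `QuantumLattice.zmod_one_ne_zero_of_two_le` / `zmod_one_add_one_ne_zero_of_three_le`) — the ingredient of unique lifting along the covering map `ℤ⁴ → (ℤ/L)⁴` (`TorusCovering.lift_unique`); (§2) for EVEN `L`, the two parallel links of a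
torus plaquette are never both axis links (`(z + 1).val` and `z.val` have opposite parities when `L` is even), so every torus plaquette has two distinct free links.  No polymer
count, no criterion, no number is typed here.  NOT a statement about any gauge theory; NOT summit-bearing.  Grade (T).
-/

noncomputable section

open Finset
open Literature.MathematicalPhysics.QuantumLattice (zmod_one_ne_zero_of_two_le zmod_one_add_one_ne_zero_of_three_le)
open Summit.QuantumFields.YangMills.Theorems.Instrument.TorusPolymerKraft (TSite TEdge TPlaquette tEdges IsAxisLinkT IsFreeLinkT)

namespace Summit.QuantumFields.YangMills.Theorems.Instrument.TorusPlaquetteGeometry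

variable {L : ℕ}

/-! ## §1 Lattice arithmetic in `ZMod L`, `L ≥ 3`, and the shared-link lemma on the torus -/

-- `(1 : ZMod L) ≠ 0` (`L ≥ 2`) and `(1 : ZMod L) + 1 ≠ 0` (`L ≥ 3`) are the tree's
-- `Literature.MathematicalPhysics.QuantumLattice.zmod_one_ne_zero_of_two_le` / `zmod_one_add_one_ne_zero_of_three_le` (MagneticHubbardTorusTrivialField).

/-- Unit vectors of the torus in different directions differ (`L ≥ 2`). [folklore] -/
theorem single_index_injective_T (hL : 2 ≤ L) {m m' : Fin 4} (h : (Pi.single m (1 : ZMod L) : TSite L) = Pi.single m' 1) : m = m' := by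
  by_contra hne
  have := congrFun h m
  rw [Pi.single_eq_same, Pi.single_eq_of_ne hne] at this
  exact zmod_one_ne_zero_of_two_le hL this

/-- `x + e_m ≠ x` on the torus (`L ≥ 2`). [folklore] -/
theorem add_single_ne_self_T (hL : 2 ≤ L) (x : TSite L) (m : Fin 4) : x + Pi.single m 1 ≠ x := by
  intro h
  have := congrFun h m
  rw [Pi.add_apply, Pi.single_eq_same, add_eq_left] at this
  exact zmod_one_ne_zero_of_two_le hL this

/-- `x + e_m + e_n ≠ x` on the torus (`L ≥ 3`). [folklore] -/
theorem add_single_add_single_ne_T (hL : 3 ≤ L) (x : TSite L) (m n : Fin 4) : x + Pi.single m 1 + Pi.single n 1 ≠ x := by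
  intro h
  have := congrFun h m
  rw [Pi.add_apply, Pi.add_apply, Pi.single_eq_same, add_assoc, add_eq_left] at this
  by_cases hmn : n = m
  · subst hmn; rw [Pi.single_eq_same] at this; exact zmod_one_add_one_ne_zero_of_three_le hL this
  · rw [Pi.single_eq_of_ne (Ne.symm hmn) , add_zero] at this; exact zmod_one_ne_zero_of_two_le (by omega) this

/-- Membership of a link of direction `i` in the link set of a torus plaquette, made explicit. [folklore] -/
theorem mk_mem_tEdges_iff (p : TPlaquette L) (y : TSite L) (i : Fin 4) :
    ((y, i) : TEdge L) ∈ tEdges p ↔ (p.2.1.1 = i ∧ (y = p.1 ∨ y = p.1 + Pi.single p.2.1.2 1)) ∨ (p.2.1.2 = i ∧ (y = p.1 + Pi.single p.2.1.1 1 ∨ y = p.1)) := by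
  obtain ⟨x, ⟨j, k⟩, hjk⟩ := p
  simp only [tEdges, mem_insert, mem_singleton, Prod.mk.injEq]
  tauto

/-- Offsets on the torus: if `x − y ∈ {0, ± e_m} ∩ {0, ± e_n}` with `m ≠ n` then `x = y` (`L ≥ 3`). [folklore] -/
theorem eq_of_offsets_T (hL : 3 ≤ L) {x y : TSite L} {m n : Fin 4} (hmn : m ≠ n)
    (h1 : x = y ∨ x = y + Pi.single m 1 ∨ y = x + Pi.single m 1) (h2 : x = y ∨ x = y + Pi.single n 1 ∨ y = x + Pi.single n 1) : x = y := by
  rcases h1 with h1 | h1 | h1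
  · exact h1
  · rcases h2 with h2 | h2 | h2
    · exact h2
    · exact absurd (single_index_injective_T (by omega) (add_left_cancel (h1.symm.trans h2))) hmn
    · exfalso; rw [h1] at h2; exact add_single_add_single_ne_T hL y m n h2.symm
  · rcases h2 with h2 | h2 | h2
    · exact h2
    · exfalso; rw [h1] at h2; exact add_single_add_single_ne_T hL x m n h2.symm
    · exact absurd (single_index_injective_T (by omega) (add_left_cancel (h1.symm.trans h2))) hmn

/-- From `z ∈ {x, x + s}` and `z ∈ {y, y + s}`: `x − y ∈ {0, ± s}`. [folklore] -/
theorem offsets_of_mem_T {z x y s : TSite L} (hp : z = x ∨ z = x + s) (hq : z = y ∨ z = y + s) : x = y ∨ x = y + s ∨ y = x + s := by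
  rcases hp with rfl | rfl <;> rcases hq with h | h
  · exact Or.inl h
  · exact Or.inr (Or.inl h)
  · exact Or.inr (Or.inr h.symm)
  · exact Or.inl (add_right_cancel h)

/-- Two PARALLEL torus links `{z₁, z₂} = {x, x + e_m} = {y, y + e_n}` force `x = y` and `m = n` (`L ≥ 3`). [folklore] -/
theorem eq_of_parallel_T (hL : 3 ≤ L) {z₁ z₂ x y : TSite L} {m n : Fin 4}
    (hp : z₁ = x ∧ z₂ = x + Pi.single m 1 ∨ z₁ = x + Pi.single m 1 ∧ z₂ = x)
    (hq : z₁ = y ∧ z₂ = y + Pi.single n 1 ∨ z₁ = y + Pi.single n 1 ∧ z₂ = y) : x = y ∧ m = n := by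
  rcases hp with ⟨rfl, rfl⟩ | ⟨rfl, rfl⟩ <;> rcases hq with ⟨h1, h2⟩ | ⟨h1, h2⟩
  · subst h1; exact ⟨rfl, single_index_injective_T (by omega) (add_left_cancel h2)⟩
  · exfalso; rw [h1] at h2; exact add_single_add_single_ne_T hL _ n m h2
  · exfalso; rw [h2] at h1; exact add_single_add_single_ne_T hL _ n m h1
  · subst h2; exact ⟨rfl, single_index_injective_T (by omega) (add_left_cancel h1)⟩

/-- ★ **Two distinct torus plaquettes share at most one link** (`L ≥ 3`): two distinct links common to `p` and `q` force `p = q`.  The `ℤ⁴` proof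
(`PlaquetteLinkGeometry.eq_of_mem_plaquetteEdges_of_ne`) verbatim over `ZMod L`. [folklore] -/
theorem eq_of_mem_tEdges_of_ne (hL : 3 ≤ L) {p q : TPlaquette L} {e₁ e₂ : TEdge L} (hne : e₁ ≠ e₂)
    (h1p : e₁ ∈ tEdges p) (h2p : e₂ ∈ tEdges p) (h1q : e₁ ∈ tEdges q) (h2q : e₂ ∈ tEdges q) : p = q := by
  obtain ⟨x, ⟨⟨i, j⟩, hij⟩⟩ := p
  obtain ⟨y, ⟨⟨k, l⟩, hkl⟩⟩ := q
  obtain ⟨z₁, m₁⟩ := e₁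
  obtain ⟨z₂, m₂⟩ := e₂
  have hij' : (i : ℕ) < j := hij
  have hkl' : (k : ℕ) < l := hkl
  rw [mk_mem_tEdges_iff] at h1p h2p h1q h2q
  simp only at h1p h2p h1q h2q
  suffices h : x = y ∧ i = k ∧ j = l by
    obtain ⟨rfl, rfl, rfl⟩ := h; rfl
  have hz : m₁ = m₂ → z₁ ≠ z₂ := by rintro rfl h; exact hne (by rw [h])
  rcases h1p with ⟨rfl, hz1p⟩ | ⟨rfl, hz1p⟩ <;> rcases h2p with ⟨h2, hz2p⟩ | ⟨h2, hz2p⟩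
  · have hz12 := hz h2
    subst h2
    have hpar : z₁ = x ∧ z₂ = x + Pi.single j 1 ∨ z₁ = x + Pi.single j 1 ∧ z₂ = x := by
      rcases hz1p with rfl | rfl <;> rcases hz2p with rfl | rfl
      · exact absurd rfl hz12
      · exact Or.inl ⟨rfl, rfl⟩
      · exact Or.inr ⟨rfl, rfl⟩
      · exact absurd rfl hz12
    rcases h1q with ⟨h1, hz1q⟩ | ⟨h1, hz1q⟩ <;> rcases h2q with ⟨h2', hz2q⟩ | ⟨h2', hz2q⟩
    · subst h1
      have hqar : z₁ = y ∧ z₂ = y + Pi.single l 1 ∨ z₁ = y + Pi.single l 1 ∧ z₂ = y := by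
        rcases hz1q with h | h <;> rcases hz2q with h' | h'
        · exact absurd (h.trans h'.symm) hz12
        · exact Or.inl ⟨h, h'⟩
        · exact Or.inr ⟨h, h'⟩
        · exact absurd (h.trans h'.symm) hz12
      obtain ⟨hxy, hjl⟩ := eq_of_parallel_T hL hpar hqar
      exact ⟨hxy, rfl, hjl⟩
    · exfalso; subst h1; subst h2'; omega
    · exfalso; subst h1; subst h2'; omega
    · subst h1
      have hqar : z₁ = y ∧ z₂ = y + Pi.single k 1 ∨ z₁ = y + Pi.single k 1 ∧ z₂ = y := by
        rcases hz1q with h | h <;> rcases hz2q with h' | h'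
        · exact absurd (h.trans h'.symm) hz12
        · exact Or.inr ⟨h, h'⟩
        · exact Or.inl ⟨h, h'⟩
        · exact absurd (h.trans h'.symm) hz12
      obtain ⟨-, hjk⟩ := eq_of_parallel_T hL hpar hqar
      exfalso; subst hjk; omega
  · subst h2
    rcases h1q with ⟨h1, hz1q⟩ | ⟨h1, hz1q⟩ <;> rcases h2q with ⟨h2', hz2q⟩ | ⟨h2', hz2q⟩
    · exfalso; subst h1; subst h2'; omega
    · subst h1; subst h2'
      have o1 := offsets_of_mem_T hz1p hz1q
      have o2 := offsets_of_mem_T (hz2p.elim Or.inr Or.inl) (hz2q.elim Or.inr Or.inl)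
      exact ⟨eq_of_offsets_T hL (fun h => by subst h; omega) o1 o2, rfl, rfl⟩
    · exfalso; subst h1; subst h2'; omega
    · exfalso; subst h1; subst h2'; omega
  · subst h2
    rcases h1q with ⟨h1, hz1q⟩ | ⟨h1, hz1q⟩ <;> rcases h2q with ⟨h2', hz2q⟩ | ⟨h2', hz2q⟩
    · exfalso; subst h1; subst h2'; omega
    · exfalso; subst h1; subst h2'; omega
    · subst h1; subst h2'
      have o1 := offsets_of_mem_T (hz1p.elim Or.inr Or.inl) (hz1q.elim Or.inr Or.inl)
      have o2 := offsets_of_mem_T hz2p hz2q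
      exact ⟨eq_of_offsets_T hL (fun h => by subst h; omega) o1 o2, rfl, rfl⟩
    · exfalso; subst h1; subst h2'; omega
  · have hz12 := hz h2
    subst h2
    have hpar : z₁ = x ∧ z₂ = x + Pi.single i 1 ∨ z₁ = x + Pi.single i 1 ∧ z₂ = x := by
      rcases hz1p with rfl | rfl <;> rcases hz2p with rfl | rfl
      · exact absurd rfl hz12
      · exact Or.inr ⟨rfl, rfl⟩
      · exact Or.inl ⟨rfl, rfl⟩
      · exact absurd rfl hz12
    rcases h1q with ⟨h1, hz1q⟩ | ⟨h1, hz1q⟩ <;> rcases h2q with ⟨h2', hz2q⟩ | ⟨h2', hz2q⟩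
    · subst h1
      have hqar : z₁ = y ∧ z₂ = y + Pi.single l 1 ∨ z₁ = y + Pi.single l 1 ∧ z₂ = y := by
        rcases hz1q with h | h <;> rcases hz2q with h' | h'
        · exact absurd (h.trans h'.symm) hz12
        · exact Or.inl ⟨h, h'⟩
        · exact Or.inr ⟨h, h'⟩
        · exact absurd (h.trans h'.symm) hz12
      obtain ⟨-, hil⟩ := eq_of_parallel_T hL hpar hqar
      exfalso; subst hil; omega
    · exfalso; subst h1; subst h2'; omega
    · exfalso; subst h1; subst h2'; omega
    · subst h1
      have hqar : z₁ = y ∧ z₂ = y + Pi.single k 1 ∨ z₁ = y + Pi.single k 1 ∧ z₂ = y := by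
        rcases hz1q with h | h <;> rcases hz2q with h' | h'
        · exact absurd (h.trans h'.symm) hz12
        · exact Or.inr ⟨h, h'⟩
        · exact Or.inl ⟨h, h'⟩
        · exact absurd (h.trans h'.symm) hz12
      obtain ⟨hxy, hik⟩ := eq_of_parallel_T hL hpar hqar
      exact ⟨hxy, hik, rfl⟩

/-! ## §2 Comb-gauge parity on an even torus: two distinct free links per plaquette -/

/-- On an even torus, `(z + 1).val` is even iff `z.val` is odd. [folklore] -/
theorem even_val_add_one_iff [NeZero L] (hLe : Even L) (z : ZMod L) : Even (z + 1).val ↔ ¬ Even z.val := by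
  have hL2 : 2 ≤ L := by
    obtain ⟨k, hk⟩ := hLe; have := NeZero.ne L; omega
  haveI : Fact (1 < L) := ⟨by omega⟩
  have hv : (z + 1).val = (z.val + 1) % L := by rw [ZMod.val_add, ZMod.val_one]
  have hlt : z.val < L := ZMod.val_lt z
  rw [hv]
  rcases Nat.lt_or_ge (z.val + 1) L with h | h
  · rw [Nat.mod_eq_of_lt h, Nat.even_add_one]
  · have heq : z.val + 1 = L := by omega
    rw [heq, Nat.mod_self]
    obtain ⟨k, hk⟩ := hLe
    constructor
    · intro _ hz; obtain ⟨m, hm⟩ := hz; omega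
    · intro _; exact ⟨0, rfl⟩

/-- The two links of direction `i` of the torus plaquette `(x; i, j)` are not both axis links (even `L`): their `j`-coordinates differ by one. [folklore] -/
theorem not_isAxisLinkT_both [NeZero L] (hLe : Even L) (x : TSite L) {i j : Fin 4} (hij : i ≠ j) :
    ¬ (IsAxisLinkT ((x, i) : TEdge L) ∧ IsAxisLinkT ((x + Pi.single j 1, i) : TEdge L)) := by
  rintro ⟨h1, h2⟩
  have e1 : Even (x j).val := h1 j (Ne.symm hij)
  have e2 : Even ((x + Pi.single j 1 : TSite L) j).val := h2 j (Ne.symm hij)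
  rw [Pi.add_apply, Pi.single_eq_same, even_val_add_one_iff hLe] at e2
  exact e2 e1

/-- ★ Every plaquette of an even torus has two distinct FREE links (one in each of its directions). [folklore] -/
theorem exists_two_freeLinksT [NeZero L] (hLe : Even L) (p : TPlaquette L) :
    ∃ g₁ ∈ tEdges p, ∃ g₂ ∈ tEdges p, g₁ ≠ g₂ ∧ IsFreeLinkT g₁ ∧ IsFreeLinkT g₂ := by
  obtain ⟨x, ⟨⟨i, j⟩, hij⟩⟩ := p
  have hij' : i ≠ j := ne_of_lt hij
  have hmem : ∀ e : TEdge L, e = (x, i) ∨ e = (x + Pi.single i 1, j) ∨ e = (x + Pi.single j 1, i) ∨ e = (x, j) →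
      e ∈ tEdges ((x, ⟨(i, j), hij⟩) : TPlaquette L) := fun e he => by
    simp only [tEdges, mem_insert, mem_singleton]; exact he
  have hi : ∃ g, g ∈ tEdges ((x, ⟨(i, j), hij⟩) : TPlaquette L) ∧ g.2 = i ∧ IsFreeLinkT g := by
    by_cases h : IsAxisLinkT ((x, i) : TEdge L)
    · exact ⟨(x + Pi.single j 1, i), hmem _ (Or.inr (Or.inr (Or.inl rfl))), rfl, fun h' => not_isAxisLinkT_both hLe x hij' ⟨h, h'⟩⟩
    · exact ⟨(x, i), hmem _ (Or.inl rfl), rfl, h⟩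
  have hj : ∃ g, g ∈ tEdges ((x, ⟨(i, j), hij⟩) : TPlaquette L) ∧ g.2 = j ∧ IsFreeLinkT g := by
    by_cases h : IsAxisLinkT ((x, j) : TEdge L)
    · exact ⟨(x + Pi.single i 1, j), hmem _ (Or.inr (Or.inl rfl)), rfl, fun h' => not_isAxisLinkT_both hLe x (Ne.symm hij') ⟨h, h'⟩⟩
    · exact ⟨(x, j), hmem _ (Or.inr (Or.inr (Or.inr rfl))), rfl, h⟩
  obtain ⟨g₁, hg₁, hd₁, hf₁⟩ := hi
  obtain ⟨g₂, hg₂, hd₂, hf₂⟩ := hj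
  exact ⟨g₁, hg₁, g₂, hg₂, fun h => hij' (hd₁.symm.trans (h ▸ hd₂)), hf₁, hf₂⟩

end Summit.QuantumFields.YangMills.Theorems.Instrument.TorusPlaquetteGeometry

end
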